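import Literature.AlgebraicGeometry.Motives.ThickeningTower
import Literature.AlgebraicGeometry.Morphisms.CechH1
import Literature.RingTheory.Flat.SmallExtensionBaseChange
import Mathlib.AlgebraicGeometry.AlgClosed.Basic
import HarnessLib

/-!
# The infinitesimal neighbourhoods `Spec(𝒪_{T,t}/𝔪^{n+1})` of a closed point of a `ℂ`-scheme as augmented small extensions over `ℂ`

For `T : SchemeOver ℂ` and a point `t` ([GortzWedhorn2023] Thm. 24.42 / Lemma 24.72: the schemes `X ×_S Spec(𝒪_{S,s}/𝔪^{n+1})`):
the levels `Rt T t n = 𝒪_{T,t}/𝔪^{n+1}` (the tree's `thickRing` at `B = ⊤`) with the CANONICAL `ℂ`-structure, the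
identification `thickeningPt_hom_eq` of the structure morphism of `thickeningPt T t n` with `Spec` of the algebra map, the
transitions `πℂ n : Rt (n+1) → Rt n` as `ℂ`-algebra maps (underlying ring map = `stalkModPowTransitionHom`), the augmentations
`ρℂ n : Rt n → ℂ` through `κ(t) = ℂ` at a CLOSED point (Mathlib `residueFieldIsoBase`, `T` locally of finite type), and — for
`T` locally Noetherian — the framed kernels `eℂ n : ℂ^{d_n} ≃ 𝔪^{n+1}/𝔪^{n+2}` making `(πℂ n, ρℂ (n+1))` an AUGMENTED SMALL
EXTENSION over `ℂ` (`level_isSmallExtension`, the tree's `thickSmallExtension` read over `ℂ`).  Consumed by the M13 model tower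
([MumfordAV1970] §13, proof of the Theorem pp. 125–130: induction on the order of the infinitesimal neighbourhood).
HC_CM is proved only modulo the 7 printed citations until rung 0 closes.

## References
* [GortzWedhorn2023] U. Görtz, T. Wedhorn, *Algebraic Geometry II*, Thm. 24.42, Lemma 24.72 (p. 409) and its proof, Step (I) (p. 410).
* [MumfordAV1970] D. Mumford, *Abelian Varieties*, §13 (proof of the Thm. pp. 125–130).
-/

noncomputable section

universe u v

open TensorProduct CategoryTheory AlgebraicGeometry
open Literature.RingTheory.Flat Literature.RingTheory.Flat.IsSmallExtension

namespace Literature.AlgebraicGeometry.Motives.AbelianVariety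

open CategoryTheory CategoryTheory.Limits AlgebraicGeometry MonoidalCategory CartesianMonoidalCategory
open Literature.AlgebraicGeometry.Morphisms IsLocalRing

section Levels

variable (T' : SchemeOver ℂ) (t : T'.left)

/-- The point `t` as an element of the open `⊤` (index for ★ `ThickeningTower`). [folklore] -/
abbrev topPt : (⊤ : T'.left.Opens) := ⟨t, TopologicalSpace.Opens.mem_top t⟩

/-- `R n := 𝒪_{T,t}/𝔪^{n+1}` (= ★ `thickRing` at `B = ⊤`), a `ℂ`-algebra through `ℂ → 𝒪_{T,t}`. [folklore] -/
abbrev Rt (n : ℕ) : Type := thickRing T' (topPt T' t) n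

/-- The `Γ(T, 𝒪_T)`-algebra structure of `𝒪_{T,t}` (Mathlib `TopCat.Presheaf.algebra_section_stalk` at the point
`⟨t, _⟩ : ⊤`; registered locally because the projection `(⟨t, _⟩ : ⊤).1` reduces to `t`). [folklore] -/
@[reducible] def algSecStalk : Algebra Γ(T'.left, ⊤) (T'.left.presheaf.stalk t) :=
  TopCat.Presheaf.algebra_section_stalk T'.left.presheaf (topPt T' t)

attribute [local instance] algSecStalk

/-- **The structure morphism of `Spec 𝒪_{T,t}` over `ℂ` is `Spec` of the canonical algebra map.** [cite: GortzWedhorn2023, Lemma 24.72 (p. 409), proof, Step (I) (p. 410)] -/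
theorem fromSpecStalk_comp_hom :
    T'.left.fromSpecStalk t ≫ T'.hom = Spec.map (CommRingCat.ofHom (algebraMap ℂ (T'.left.presheaf.stalk t))) := by
  have h1 : CommRingCat.ofHom (algebraMap ℂ (T'.left.presheaf.stalk t)) =
      (Scheme.ΓSpecIso (.of ℂ)).inv ≫ T'.hom.appTop ≫ T'.left.presheaf.germ ⊤ t _root_.trivial := rfl
  rw [h1, Spec.map_comp, Spec.map_comp, ← Scheme.fromSpecStalk_toSpecΓ, Category.assoc, Category.assoc,
    ← Scheme.toSpecΓ_naturality_assoc, toSpecΓ_SpecMap_ΓSpecIso_inv, Category.comp_id]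

/-- **The structure morphism of the thickening is `Spec` of the canonical algebra map.** [cite: GortzWedhorn2023, Lemma 24.72 (p. 409), proof, Step (I) (p. 410)] -/
theorem thickeningPt_hom_eq (n : ℕ) :
    (thickeningPt T' t n).hom = Spec.map (CommRingCat.ofHom (algebraMap ℂ (Rt T' t n))) := by
  rw [thickeningPt_hom, fromSpecStalk_comp_hom, ← Spec.map_comp]
  rfl

/-- **`π n : R (n+1) → R n`** as a `ℂ`-algebra map (underlying ring map = ★ `thickπ`). [folklore] -/
def πℂ (n : ℕ) : Rt T' t (n + 1) →ₐ[ℂ] Rt T' t n := Ideal.Quotient.factorₐ ℂ (pow_succ_le T' (topPt T' t) n)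

/-- `πℂ` is `thickπ` as a function. [cite: GortzWedhorn2023, Lemma 24.72 (p. 409), proof, Step (I) (p. 410)] -/
theorem πℂ_apply (n : ℕ) (r : Rt T' t (n + 1)) : πℂ T' t n r = thickπ T' (topPt T' t) n r := by
  obtain ⟨r, rfl⟩ := Ideal.Quotient.mk_surjective r
  rfl

/-- `πℂ` underlies ★ `stalkModPowTransition` (for the classifying maps along `thickeningPtTransition`). [cite: GortzWedhorn2023, Lemma 24.72 (p. 409), proof, Step (I) (p. 410)] -/
theorem πℂ_toRingHom (n : ℕ) :
    (πℂ T' t n : Rt T' t (n + 1) →+* Rt T' t n) = stalkModPowTransitionHom T' t n := by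
  apply RingHom.ext; intro r
  obtain ⟨r, rfl⟩ := Ideal.Quotient.mk_surjective r
  rfl

/-- `πℂ.toRingHom` underlies ★ `stalkModPowTransition` (`AlgHom.toRingHom` form). [cite: GortzWedhorn2023, Lemma 24.72 (p. 409), proof, Step (I) (p. 410)] -/
theorem πℂ_toRingHom' (n : ℕ) : (πℂ T' t n).toRingHom = stalkModPowTransitionHom T' t n := πℂ_toRingHom T' t n

/-- `Spec` of the `ℂ`-algebra transition is ★ `thickeningPtTransition` on underlying schemes. [cite: GortzWedhorn2023, Lemma 24.72 (p. 409), proof, Step (I) (p. 410)] -/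
theorem specMap_πℂ (n : ℕ) :
    Spec.map (CommRingCat.ofHom (πℂ T' t n).toRingHom) = (thickeningPtTransition T' t n).left := by
  rw [thickeningPtTransition_left, stalkModPowTransition, πℂ_toRingHom']
  rfl

variable [LocallyOfFiniteType T'.hom] (ht : IsClosed ({t} : Set T'.left))

/-- `κ(t) → ℂ` (Mathlib's `residueFieldIsoBase`), as a ring map out of ★ `resField`. [folklore] -/
def κhom : resField T' (topPt T' t) →+* ℂ := (residueFieldIsoBase T'.hom t ht).hom.hom

/-- The inverse of `residueFieldIsoBase` is the canonical structure map `ℂ → κ(t)`. [cite: GortzWedhorn2023, Lemma 24.72 (p. 409), proof, Step (I) (p. 410)] -/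
theorem residueFieldIsoBase_inv_eq :
    (residueFieldIsoBase T'.hom t ht).inv = CommRingCat.ofHom (algebraMap ℂ (resField T' (topPt T' t))) := by
  apply Spec.map_injective
  rw [SpecMap_residueFieldIsoBase_inv]
  have h1 : CommRingCat.ofHom (algebraMap ℂ (resField T' (topPt T' t))) =
      CommRingCat.ofHom (algebraMap ℂ (T'.left.presheaf.stalk t)) ≫ T'.left.residue t := rfl
  rw [h1, Spec.map_comp, ← fromSpecStalk_comp_hom]
  rfl

/-- `κhom ∘ algebraMap = id`. [cite: GortzWedhorn2023, Lemma 24.72 (p. 409), proof, Step (I) (p. 410)] -/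
@[simp] theorem κhom_algebraMap (c : ℂ) : κhom T' t ht (algebraMap ℂ (resField T' (topPt T' t)) c) = c := by
  have := congrArg (fun φ : CommRingCat.of ℂ ⟶ CommRingCat.of ℂ => φ.hom c) (residueFieldIsoBase T'.hom t ht).inv_hom_id
  rw [residueFieldIsoBase_inv_eq] at this
  exact this

/-- `algebraMap ∘ κhom = id`. [cite: GortzWedhorn2023, Lemma 24.72 (p. 409), proof, Step (I) (p. 410)] -/
@[simp] theorem algebraMap_κhom (k : resField T' (topPt T' t)) : algebraMap ℂ (resField T' (topPt T' t)) (κhom T' t ht k) = k := by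
  have := congrArg (fun φ : T'.left.residueField t ⟶ T'.left.residueField t => φ.hom k)
    (residueFieldIsoBase T'.hom t ht).hom_inv_id
  rw [residueFieldIsoBase_inv_eq] at this
  exact this

/-- `κhom` is injective. [cite: GortzWedhorn2023, Lemma 24.72 (p. 409), proof, Step (I) (p. 410)] -/
theorem κhom_injective : Function.Injective (κhom T' t ht) := fun a b h => by
  rw [← algebraMap_κhom T' t ht a, ← algebraMap_κhom T' t ht b, h]

omit [LocallyOfFiniteType T'.hom] in
/-- `thickρ` is a `ℂ`-algebra map. [cite: GortzWedhorn2023, Lemma 24.72 (p. 409), proof, Step (I) (p. 410)] -/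
theorem thickρ_algebraMap (n : ℕ) (c : ℂ) :
    thickρ T' (topPt T' t) n (algebraMap ℂ (Rt T' t n) c) = algebraMap ℂ (resField T' (topPt T' t)) c := rfl

/-- **`ρ n : R n → ℂ`**, the augmentation through `κ(t) = ℂ`. [folklore] -/
def ρℂ (n : ℕ) : Rt T' t n →ₐ[ℂ] ℂ :=
  { (κhom T' t ht).comp (thickρ T' (topPt T' t) n : Rt T' t n →+* resField T' (topPt T' t)) with
    commutes' := fun c => by
      change κhom T' t ht (thickρ T' (topPt T' t) n (algebraMap ℂ (Rt T' t n) c)) = c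
      rw [thickρ_algebraMap, κhom_algebraMap] }

/-- `ρℂ` is `κhom ∘ thickρ` as a function. [cite: GortzWedhorn2023, Lemma 24.72 (p. 409), proof, Step (I) (p. 410)] -/
theorem ρℂ_apply (n : ℕ) (r : Rt T' t n) : ρℂ T' t ht n r = κhom T' t ht (thickρ T' (topPt T' t) n r) := rfl

/-- `ρ n ∘ π n = ρ (n+1)`. [cite: GortzWedhorn2023, Lemma 24.72 (p. 409), proof, Step (I) (p. 410)] -/
theorem ρℂ_comp_πℂ (n : ℕ) : (ρℂ T' t ht n).comp (πℂ T' t n) = ρℂ T' t ht (n + 1) := by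
  apply AlgHom.ext; intro r
  obtain ⟨r, rfl⟩ := Ideal.Quotient.mk_surjective r
  rfl

variable [IsLocallyNoetherian T'.left]

/-- **The framed kernel over `ℂ`**: `e n v := thickFrame (algebraMap ∘ v)`. [folklore] -/
def eℂ (n : ℕ) : (Fin (thickDim T' (topPt T' t) n) → ℂ) ≃ₗ[ℂ] thickKer T' (topPt T' t) n where
  toFun v := thickFrame T' (topPt T' t) n (fun ℓ => algebraMap ℂ (resField T' (topPt T' t)) (v ℓ))
  invFun y ℓ := κhom T' t ht ((thickFrame T' (topPt T' t) n).symm y ℓ)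
  map_add' v w := by
    have : (fun ℓ => algebraMap ℂ (resField T' (topPt T' t)) ((v + w) ℓ)) =
        (fun ℓ => algebraMap ℂ (resField T' (topPt T' t)) (v ℓ)) + fun ℓ => algebraMap ℂ (resField T' (topPt T' t)) (w ℓ) := by
      funext ℓ; simp
    rw [this]
    exact (thickFrame T' (topPt T' t) n).map_add _ _
  map_smul' c v := by
    have hc : (fun ℓ => algebraMap ℂ (resField T' (topPt T' t)) ((c • v) ℓ)) =
        fun ℓ => thickρ T' (topPt T' t) (n + 1) (algebraMap ℂ (Rt T' t (n + 1)) c) *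
          algebraMap ℂ (resField T' (topPt T' t)) (v ℓ) := by
      funext ℓ; rw [thickρ_algebraMap, Pi.smul_apply, smul_eq_mul, map_mul]
    rw [hc]
    apply Subtype.ext
    rw [thickFrame_smul T' (topPt T' t) n, RingHom.id_apply, Submodule.coe_smul_of_tower]
    exact (Algebra.smul_def c _).symm
  left_inv v := by
    funext ℓ
    change κhom T' t ht ((thickFrame T' (topPt T' t) n).symm (thickFrame T' (topPt T' t) n _) ℓ) = v ℓ
    rw [LinearEquiv.symm_apply_apply, κhom_algebraMap]
  right_inv y := by
    have : (fun ℓ => algebraMap ℂ (resField T' (topPt T' t)) (κhom T' t ht ((thickFrame T' (topPt T' t) n).symm y ℓ))) =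
        (thickFrame T' (topPt T' t) n).symm y := by
      funext ℓ; exact algebraMap_κhom T' t ht _
    change thickFrame T' (topPt T' t) n _ = y
    rw [this, LinearEquiv.apply_symm_apply]

/-- Unfolding of `eℂ`. [cite: GortzWedhorn2023, Lemma 24.72 (p. 409), proof, Step (I) (p. 410)] -/
theorem eℂ_apply (n : ℕ) (v : Fin (thickDim T' (topPt T' t) n) → ℂ) :
    (eℂ T' t ht n v : Rt T' t (n + 1)) =
      (thickFrame T' (topPt T' t) n (fun ℓ => algebraMap ℂ (resField T' (topPt T' t)) (v ℓ)) : Rt T' t (n + 1)) :=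
  rfl

/-- **`R (n+1) → R n` is an AUGMENTED small extension over `ℂ`** (★ `thickSmallExtension` read through `κ(t) = ℂ`).
[cite: GortzWedhorn2023, Lemma 24.72, proof (p. 548)] -/
theorem level_isSmallExtension (n : ℕ) :
    IsSmallExtension (πℂ T' t n) (ρℂ T' t ht (n + 1)) (thickKer T' (topPt T' t) n) (eℂ T' t ht n) where
  surjective_π := fun y => by
    obtain ⟨r, hr⟩ := thickπ_surjective T' (topPt T' t) n y
    exact ⟨r, by rw [πℂ_apply, hr]⟩
  surjective_ρ := fun c => by
    obtain ⟨r, hr⟩ := thickρ_surjective T' (topPt T' t) (n + 1) (algebraMap ℂ (resField T' (topPt T' t)) c)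
    exact ⟨r, by rw [ρℂ_apply, hr, κhom_algebraMap]⟩
  mem_ker_π := fun y => by rw [πℂ_apply]; exact thickπ_eq_zero_iff_mem T' (topPt T' t) n y
  isNilpotent_ker_ρ := by
    have h := (thickSmallExtension T' (topPt T' t) n).isNilpotent_ker_ρ
    have hker : RingHom.ker (ρℂ T' t ht (n + 1)) = RingHom.ker (thickρ T' (topPt T' t) (n + 1)) := by
      ext r
      rw [RingHom.mem_ker, RingHom.mem_ker]
      change κhom T' t ht (thickρ T' (topPt T' t) (n + 1) r) = 0 ↔ _
      constructor
      · intro h0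
        exact κhom_injective T' t ht (by rw [h0, map_zero])
      · intro h0; rw [h0, map_zero]
    rw [hker]; exact h
  smul_e := fun r v => by
    rw [eℂ_apply, eℂ_apply]
    have : (fun ℓ => algebraMap ℂ (resField T' (topPt T' t)) (ρℂ T' t ht (n + 1) r * v ℓ)) =
        fun ℓ => thickρ T' (topPt T' t) (n + 1) r * algebraMap ℂ (resField T' (topPt T' t)) (v ℓ) := by
      funext ℓ; rw [map_mul, ρℂ_apply, algebraMap_κhom]
    rw [this, thickFrame_smul T' (topPt T' t) n r]

end Levels

end Literature.AlgebraicGeometry.Motives.AbelianVariety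

end
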